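import Mathlib
import HarnessLib
import Literature.MathematicalPhysics.StatisticalMechanics.LinearisedMapNorm
import Literature.MathematicalPhysics.StatisticalMechanics.LinearisedMapBlockTermKernelSub
import Literature.MathematicalPhysics.StatisticalMechanics.LinearisedMapLargePartKernelSub

/-!
# Lemma 10.1 for the DIFFERENCE of two step kernels: `‖C_k^{(q)}K − C_k^{(q')}K‖_{k+1}^{(A)} ≤ ℓ (L^d c_G' + ε) ‖K‖_k^{(A)}`
# ([ABKM19] Lemma 10.1 ⊗ Lemma 8.4 (`ℓ = 1`); the linear part of hypothesis (12.53) of Lemma 12.6)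

The linearisation `C_k K = G + F` of the renormalisation map (`LinearisedMap.opC`) depends on the step
kernel through the fluctuation integral.  For two step data `Da, Db` of scale `k` sharing `s, L, B₀, c₀`
(kernels `𝒞a, 𝒞b`), `C_a K − C_b K = Σ_B (G_a(B) − G_b(B)) + (F_a − F_b)`, and the two-kernel twins of
Lemmas 10.3–10.4 (`tayNormLE_blockTerm_sub`) and Lemma 10.2 (`tayNormLE_largePart_fluct_sub`) assemble
exactly as in Lemma 10.1:

* `opC_sub_eq` — the decomposition of the difference;
* **`tayNormLE_opC_sub`** — abstract assembly (twin of `tayNormLE_opC`);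
* **`weakNormLE_opC_sub`** — norm form (twin of `weakNormLE_opC`):
  `‖C_a K − C_b K‖_{k+1}^{(A)} ≤ C · (L^d · 1536 ℓκ c_G + ℓ ε(A, κ))` from the `ℓ = 1` integration
  property of the pair (`hdint`, constant `C·ℓ·κ^{|X|_k}`).

This is the part of `S_{q}(H,K) − S_{q'}(H,K)` that is LINEAR in `K`; with `ℓ ∝ |q − q'|`
(`TuningLipschitzPackaging`) it is of the size `l·|q−q'|·‖K‖` required by hypothesis `hl` of
`RGFlow.exists_isTunedQ_initial_eq_of_finiteDimensional`.  Everything is proved; no named fact.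

## References
* S. Adams, S. Buchholz, R. Kotecký, S. Müller, arXiv:1910.13564, Lemma 10.1, Lemma 12.6 (12.53)
  [AdamsBuchholzKoteckyMuller2019].
-/

noncomputable section

namespace Literature.MathematicalPhysics.StatisticalMechanics.GradientRG

open scoped BigOperators Classical
open Finset
open Literature.MathematicalPhysics.StatisticalMechanics.TorusPolymer
  (IsPolymer blocks numBlocks closure blockOf thicken reblock boxCorner card_blocks_eq_numBlocks)
open Literature.Barriers.CriticalPhenomena.LongRangePhi4.Polymer (IsConn)
open Literature.MathematicalPhysics.QuantumFieldTheory

variable {d M : ℕ} [NeZero M]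

/-- The difference of the linearisations of two step data sharing `s, L`:
`C_a K U − C_b K U = Σ_B (G_a(B) − G_b(B)) + largePart (R_a − R_b) K U`.
[cite: AdamsBuchholzKoteckyMuller2019, Theorem 6.8 (6.58)] -/
theorem opC_sub_eq (Da Db : StepData d M) (hs : Db.s = Da.s) (hL : Db.L = Da.L)
    (K : Finset (Fin d → ZMod M) → ((Fin d → ZMod M) → ℝ) → ℂ) (U : Finset (Fin d → ZMod M)) :
    opC Da K U - opC Db K U =
      (fun φ => ∑ B ∈ blockPartIndex Da U, (blockTerm Da K B φ - blockTerm Db K B φ)) +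
        largePart Da.s Da.L (fun F φ => fluct Da.𝒞 F φ - fluct Db.𝒞 F φ) K U := by
  have hidx : blockPartIndex Db U = blockPartIndex Da U := by
    unfold blockPartIndex; rw [hs, hL]
  funext φ
  simp only [opC, blockPart, largePart, Pi.sub_apply, Pi.add_apply, hidx, hs, hL, sum_sub_distrib]
  ring

section Bounds

variable {V : Type*} [NormedAddCommGroup V] [NormedSpace ℝ V]

/-- **Lemma 10.1 (assembly) for the difference of two step kernels**: per-block bounds
`|G_a(B) − G_b(B)|_{T_φ} ≤ C c_G A^{−1} w(φ)` and per-polymer bounds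
`|(R_a − R_b)K(X)|_{T_φ} ≤ C κ^{|X|_k} A^{−|X|_k} w(φ)` with the closure gain give
`|(C_a K − C_b K)(U)|_{T_φ} ≤ C (L^d c_G + ε(A)) A^{−|U|_{k+1}} w(φ)`.
[cite: AdamsBuchholzKoteckyMuller2019, Lemma 10.1] -/
theorem tayNormLE_opC_sub (Da Db : StepData d M) (hsb : Db.s = Da.s) (hLb : Db.L = Da.L) {t : ℕ}
    (hM : M = Da.L * Da.s * t) (hs : Odd Da.s)
    (hL : Odd Da.L) (ht : Odd t) (T : ((Fin d → ZMod M) → ℝ) →ₗ[ℝ] V)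
    {w : ((Fin d → ZMod M) → ℝ) → ℝ} (hw : ∀ φ, 0 ≤ w φ) {r₀ : ℕ}
    {K : Finset (Fin d → ZMod M) → ((Fin d → ZMod M) → ℝ) → ℂ} {A κ η C cG : ℝ} (hA : 1 ≤ A)
    (hκ : 0 ≤ κ) (hκA : κ ≤ A) (hη : 0 < η) (hC : 0 ≤ C) (hcG : 0 ≤ cG)
    (hsmall : (2 : ℝ) ^ (Da.L ^ d) * (κ * A ^ (-(1 - η⁻¹) : ℝ)) ≤ 1)
    (hgain : ∀ X : Finset (Fin d → ZMod M), IsPolymer Da.s X → IsConn X → 2 ^ d < (blocks Da.s X).card →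
      η * ((blocks (Da.L * Da.s) (closure (Da.L * Da.s) X)).card : ℝ) ≤ (blocks Da.s X).card)
    {U : Finset (Fin d → ZMod M)} (hU : IsPolymer (Da.L * Da.s) U) (hUne : U.Nonempty)
    (hGd : ∀ B ∈ blockPartIndex Da U, ContDiff ℝ r₀ (blockTerm Da K B - blockTerm Db K B))
    (hG : ∀ B ∈ blockPartIndex Da U, TayNormLE T r₀ w (blockTerm Da K B - blockTerm Db K B) (C * cG * A⁻¹))
    (hRd : ∀ X ∈ largePartIndex Da.s Da.L U, ContDiff ℝ r₀ (fluct Da.𝒞 (K X) - fluct Db.𝒞 (K X)))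
    (hR : ∀ X ∈ largePartIndex Da.s Da.L U,
      TayNormLE T r₀ w (fluct Da.𝒞 (K X) - fluct Db.𝒞 (K X))
        (C * (κ ^ (blocks Da.s X).card * (A ^ (blocks Da.s X).card)⁻¹))) :
    TayNormLE T r₀ w (opC Da K U - opC Db K U)
      (C * (Da.L ^ d * cG + largePartEps d Da.L A κ η) * (A ^ (blocks (Da.L * Da.s) U).card)⁻¹) := by
  have hA0 : 0 < A := by linarith
  rw [opC_sub_eq Da Db hsb hLb]
  set Rd : (((Fin d → ZMod M) → ℝ) → ℂ) → ((Fin d → ZMod M) → ℝ) → ℂ :=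
    fun F φ => fluct Da.𝒞 F φ - fluct Db.𝒞 F φ with hRd_def
  have hRdK : ∀ X, Rd (K X) = fluct Da.𝒞 (K X) - fluct Db.𝒞 (K X) := fun X => by
    funext φ; simp only [hRd_def, Pi.sub_apply]
  -- block part
  have h1 := TayNormLE.sum (blockPartIndex Da U) (F := fun B => blockTerm Da K B - blockTerm Db K B) hG hGd
  obtain ⟨hcard, hone⟩ := card_blockPartIndex_le Da hM hs hL ht U
  have hle : ∑ B ∈ blockPartIndex Da U, C * cG * A⁻¹
      ≤ C * (Da.L ^ d * cG) * (A ^ (blocks (Da.L * Da.s) U).card)⁻¹ := by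
    by_cases he : blockPartIndex Da U = ∅
    · rw [he, sum_empty]; positivity
    rw [hone he, pow_one, sum_const, nsmul_eq_mul]
    have : ((blockPartIndex Da U).card : ℝ) ≤ Da.L ^ d := by exact_mod_cast hcard
    calc ((blockPartIndex Da U).card : ℝ) * (C * cG * A⁻¹) ≤ (Da.L : ℝ) ^ d * (C * cG * A⁻¹) :=
          mul_le_mul_of_nonneg_right this (by positivity)
      _ = C * (Da.L ^ d * cG) * A⁻¹ := by ring
  have h1' := h1.mono hle hw
  -- large part
  have h2 := tayNormLE_largePart hM hs hL ht T hw (R := Rd) (K := K) hA hκ hκA hη hC hsmall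
    hgain hU hUne (fun X hX => by rw [hRdK]; exact hRd X hX) (fun X hX => by rw [hRdK]; exact hR X hX)
  have hd1 : ContDiff ℝ r₀ (fun φ => ∑ B ∈ blockPartIndex Da U, (blockTerm Da K B φ - blockTerm Db K B φ)) := by
    refine ContDiff.sum fun B hB => ?_
    have := hGd B hB
    exact this
  have hd2 : ContDiff ℝ r₀ (largePart Da.s Da.L Rd K U) := by
    have : largePart Da.s Da.L Rd K U = fun φ => ∑ X ∈ largePartIndex Da.s Da.L U, Rd (K X) φ := rfl
    rw [this]
    refine ContDiff.sum fun X hX => ?_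
    rw [hRdK]; exact hRd X hX
  have h1'' : TayNormLE T r₀ w (fun φ => ∑ B ∈ blockPartIndex Da U, (blockTerm Da K B φ - blockTerm Db K B φ))
      (C * (Da.L ^ d * cG) * (A ^ (blocks (Da.L * Da.s) U).card)⁻¹) := by
    intro φ
    have := h1' φ
    convert this using 2
    funext ψ
    simp only [Pi.sub_apply]
  have h := h1''.add h2 hd1 hd2
  intro φ
  refine (h φ).trans (le_of_eq ?_)
  ring

end Bounds

/-- **Lemma 10.1 (norm form) for the difference of two step kernels**:
`‖C_a K − C_b K‖_{k+1}^{(A)} ≤ C · (L^d · 1536 ℓκ c_G + ℓ ε(A, κ))` for step data `D, Db` of scale `k`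
sharing `s, L, B₀, c₀`, under the hypotheses of `weakNormLE_opC` with the integration property
replaced by the `ℓ = 1` property of the pair (`hdint`) and `C^{r₀}` fluctuation integrals under both
kernels. [cite: AdamsBuchholzKoteckyMuller2019, Lemma 10.1 / Lemma 12.6 (12.53)] -/
theorem weakNormLE_opC_sub (P : NormParams d M) {k t : ℕ} (hM : M = P.L ^ (k + 1) * t)
    (hL : Odd P.L) (ht : Odd t) (D Db : StepData d M) (hDs : D.s = P.L ^ k) (hDL : D.L = P.L)
    {x₀ : Fin d → ZMod M} (hB₀ : D.B₀ = blockOf (P.L ^ k) x₀)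
    (hc₀ : D.c₀ = boxCorner (P.L ^ k) (P.rad k) x₀) (hC𝒞 : (Matrix.circulant D.𝒞).PosSemidef)
    (hDbs : Db.s = D.s) (hDbL : Db.L = D.L) (hDbB : Db.B₀ = D.B₀) (hDbc : Db.c₀ = D.c₀)
    (hC𝒞b : (Matrix.circulant Db.𝒞).PosSemidef)
    -- gauges of the two scales
    (h𝔥 : 0 < P.𝔥 (k + 1)) (h𝔥le : P.𝔥 (k + 1) ≤ P.𝔥 k) {κ₁ : ℝ} (hκ₁ : P.𝔥 (k + 1) ≤ κ₁ * P.𝔥 k)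
    (hR : 0 < P.R k) (hRsucc : P.R (k + 1) = P.L * P.R k)
    (hθ : P.𝔥 (k + 1) / P.𝔥 k * (P.R k / P.R (k + 1)) ≤ 1)
    (hp : d / 2 + 2 ≤ P.p) (hr₀ : 3 ≤ P.r₀) (hrad : P.rad k ≤ P.rad (k + 1))
    (hrad' : P.rad k + (2 ^ d - 1) * P.L ^ k ≤ P.rad (k + 1))
    -- the box `B*`
    (hwrap : 4 * ((P.L ^ k - 1) / 2 + P.rad k) < M)
    (hroom : ((2 * ((P.L ^ k - 1) / 2 + P.rad k) : ℕ) + (P.p : ℤ)) * 2 < M)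
    {C₁ C₀ : ℝ} (hC₁ : 0 ≤ C₁) (hρ : ((2 * ((P.L ^ k - 1) / 2 + P.rad k) : ℕ) : ℝ) ≤ C₁ * P.R k)
    (hC₀ : 1 ≤ C₀) (hρ0 : ((2 * ((P.L ^ k - 1) / 2 + P.rad k) : ℕ) : ℝ) + (d / 2 + 1 : ℕ) ≤ C₀ * P.R k)
    -- weights
    {nb : ℕ → Finset (Fin d → ZMod M) → Finset (Fin d → ZMod M)} (hWl : P.W.Local nb)
    (hnb : ∀ X, nb k X ⊆ thicken (P.rad k) X)
    {Dm : ℕ → Matrix (Fin d → ZMod M) (Fin d → ZMod M) ℝ} (hWd : P.W.Dominated Dm) (hWm : P.W.Monotone)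
    (hw6 : NextWeightDominates P k) (hw9 : ∀ U, IsPolymer (P.L ^ (k + 1)) U → W9At P k U)
    -- pair integration property, large-set parameter, gain
    {ℓ κ η : ℝ} (hℓ : 0 ≤ ℓ) (hκ : 0 ≤ κ) (hκA : κ ≤ P.A) (hA : 1 ≤ P.A) (hη : 0 < η)
    (hdint : ∀ X : Finset (Fin d → ZMod M), IsPolymer (P.L ^ k) X → IsConn X →
      ∀ (F : ((Fin d → ZMod M) → ℝ) → ℂ) (C : ℝ), 0 ≤ C → ContDiff ℝ P.r₀ F →
        IsGaugeLocal (P.gauge k X) F → TayNormLE (P.gauge k X) P.r₀ (P.W.weight k X) F C →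
          TayNormLE (P.gauge k X) P.r₀ (P.W.midWeight k X) (fluct D.𝒞 F - fluct Db.𝒞 F)
            (C * ℓ * κ ^ numBlocks (P.L ^ k) X))
    (hsmall : (2 : ℝ) ^ (P.L ^ d) * (κ * P.A ^ (-(1 - η⁻¹) : ℝ)) ≤ 1)
    (hgain : ∀ X : Finset (Fin d → ZMod M), IsPolymer (P.L ^ k) X → IsConn X →
      2 ^ d < (blocks (P.L ^ k) X).card →
        η * ((blocks (P.L * P.L ^ k) (closure (P.L * P.L ^ k) X)).card : ℝ) ≤ (blocks (P.L ^ k) X).card)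
    -- the activity
    {K : Finset (Fin d → ZMod M) → ((Fin d → ZMod M) → ℝ) → ℂ} {C : ℝ} (hC : 0 ≤ C)
    (hK : WeakNormLE P k K C) (hKt : TransInv D.s K) (hKd : ∀ X, ContDiff ℝ P.r₀ (K X))
    (hKloc : ∀ X, IsPolymer (P.L ^ k) X → IsConn X → IsGaugeLocal (P.gauge k X) (K X))
    (hRd : ∀ X, ContDiff ℝ P.r₀ (fluct D.𝒞 (K X))) (hRb : ∀ X, ContDiff ℝ P.r₀ (fluct Db.𝒞 (K X))) :
    WeakNormLE P (k + 1) (opC D K - opC Db K)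
      (C * ((P.L : ℝ) ^ d * (1536 * (ℓ * κ) * blockContrConst d (P.𝔥 k) (P.𝔥 (k + 1)) (P.R k) (P.R (k + 1))
        P.L κ₁ C₁ C₀) + ℓ * largePartEps d P.L P.A κ η)) := by
  intro U hU hcU
  have hLs : P.L * P.L ^ k = P.L ^ (k + 1) := (pow_succ' P.L k).symm
  have hLDs : D.L * D.s = P.L ^ (k + 1) := by rw [hDL, hDs, hLs]
  have hM' : M = D.L * D.s * t := hM.trans (by rw [hLDs])
  have hRle : P.R k ≤ P.R (k + 1) := by
    rw [hRsucc]
    have h1 : (1 : ℝ) ≤ P.L := by exact_mod_cast hL.pos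
    nlinarith
  set cG := 1536 * κ * blockContrConst d (P.𝔥 k) (P.𝔥 (k + 1)) (P.R k) (P.R (k + 1)) P.L κ₁ C₁ C₀
    with hcG
  -- the per-block bounds (Lemmas 10.3–10.4 for the pair)
  have hG : ∀ B ∈ blockPartIndex D U, TayNormLE (P.gauge (k + 1) U) P.r₀ (P.W.weight (k + 1) U)
      (blockTerm D K B - blockTerm Db K B) (C * ℓ * cG * P.A⁻¹) := fun B hB =>
    (tayNormLE_blockTerm_sub P hM hL ht D Db hDs hB₀ hc₀ hC𝒞 hDbs hDbB hDbc hC𝒞b h𝔥 h𝔥le hκ₁ hR hRsucc hθ hp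
      hr₀ hrad hwrap hroom hC₁ hρ hC₀ hρ0 hWl hnb hWd hWm hℓ hκ hdint hC hK hKt hKd hKloc hRd hRb hA (hw9 U hU)
      hB).mono (le_of_eq (by rw [hcG]; ring)) fun φ => (P.W.weight_pos (k + 1) U φ).le
  have hκ₁0 : 0 ≤ κ₁ := ((mul_pos_iff_of_pos_right (h𝔥.trans_le h𝔥le)).1 (h𝔥.trans_le hκ₁)).le
  have hcG0 : 0 ≤ cG := by
    have := blockContrConst_nonneg d (h𝔥.trans_le h𝔥le) h𝔥.le hR.le (hR.trans_le hRle)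
      (show (0 : ℝ) < (P.L : ℝ) by exact_mod_cast hL.pos) hκ₁0 hC₁ (show (0 : ℝ) ≤ C₀ by linarith)
    rw [hcG]; positivity
  -- the per-polymer bounds (Lemma 8.4 (ℓ = 1) + 8.1 + (w6)) with constant `C ℓ`
  have hMk : M = P.L ^ k * (P.L * t) := hM.trans (by rw [pow_succ]; ring)
  have hA0 : 0 < P.A := by linarith
  have hRbd : ∀ X ∈ largePartIndex D.s D.L U, TayNormLE (P.gauge (k + 1) U) P.r₀ (P.W.weight (k + 1) U)
      (fluct D.𝒞 (K X) - fluct Db.𝒞 (K X))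
      (C * ℓ * (κ ^ (blocks D.s X).card * (P.A ^ (blocks D.s X).card)⁻¹)) := by
    intro X hX
    obtain ⟨hPX, hcX, -, hr⟩ := mem_largePartIndex.1 hX
    rw [hDs] at hPX hr ⊢
    rw [hDL] at hr
    have h1 := hdint X hPX hcX (K X) (C * P.aFactor k X)
      (mul_nonneg hC (WeakNormLE.aFactor_pos hA0 k X).le) (hKd X) (hKloc X hPX hcX) (hK X hPX hcX)
    have hloca : IsGaugeLocal (P.gauge k X) (fluct D.𝒞 (K X)) :=
      isGaugeLocal_integral (P.gauge k X) (stepMeasure D.𝒞) fun ξ => (hKloc X hPX hcX).comp_add_right _ ξ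
    have hlocb : IsGaugeLocal (P.gauge k X) (fluct Db.𝒞 (K X)) :=
      isGaugeLocal_integral (P.gauge k X) (stepMeasure Db.𝒞) fun ξ => (hKloc X hPX hcX).comp_add_right _ ξ
    have hloc : IsGaugeLocal (P.gauge k X) (fluct D.𝒞 (K X) - fluct Db.𝒞 (K X)) := fun φ ψ hφψ => by
      simp only [Pi.sub_apply]
      rw [hloca φ ψ hφψ, hlocb φ ψ hφψ]
    have h2 : TayNormLE (P.gauge (k + 1) U) P.r₀ (P.W.midWeight k X) (fluct D.𝒞 (K X) - fluct Db.𝒞 (K X))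
        (C * P.aFactor k X * ℓ * κ ^ numBlocks (P.L ^ k) X) := by
      rw [← hr]
      exact h1.of_le_gauge (fun ξ => norm_gauge_le_norm_gauge_succ P hMk hL (hL.mul ht) h𝔥 h𝔥le hR hRle
        hrad hrad' X ξ) ((hRd X).sub (hRb X)) hloc
    have hc0 : 0 ≤ C * P.aFactor k X * ℓ * κ ^ numBlocks (P.L ^ k) X :=
      mul_nonneg (mul_nonneg (mul_nonneg hC (WeakNormLE.aFactor_pos hA0 k X).le) hℓ) (pow_nonneg hκ _)
    have h3 : TayNormLE (P.gauge (k + 1) U) P.r₀ (P.W.weight (k + 1) U) (fluct D.𝒞 (K X) - fluct Db.𝒞 (K X))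
        (C * P.aFactor k X * ℓ * κ ^ numBlocks (P.L ^ k) X) :=
      h2.mono_weight hc0 fun φ => by rw [← hr]; exact hw6 X hPX hcX φ
    refine h3.mono (le_of_eq ?_) fun φ => (P.W.weight_pos (k + 1) U φ).le
    rw [NormParams.aFactor, ← card_blocks_eq_numBlocks]; ring
  have hmain := tayNormLE_opC_sub D Db hDbs hDbL hM' (hDs ▸ hL.pow) (hDL ▸ hL) ht (P.gauge (k + 1) U)
    (w := P.W.weight (k + 1) U) (fun φ => (P.W.weight_pos (k + 1) U φ).le) (K := K) hA hκ hκA hη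
    (mul_nonneg hC hℓ) hcG0 (by rwa [hDL]) (by rw [hDs, hDL]; exact hgain) (by rwa [hLDs]) hcU.1
    (fun B _ => (contDiff_blockTerm D hRd B).sub (contDiff_blockTerm Db hRb B)) hG
    (fun X _ => (hRd X).sub (hRb X)) hRbd
  refine hmain.mono (le_of_eq ?_) fun φ => (P.W.weight_pos (k + 1) U φ).le
  rw [NormParams.aFactor, ← card_blocks_eq_numBlocks, hLDs, hDL]
  ring

end Literature.MathematicalPhysics.StatisticalMechanics.GradientRG

end
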